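import Summits.QuantumFields.BalabanUV.Beta.EriceRemainderEnclosureHistoryAutonomyExistence

/-!
# EriceRemainderEnclosureHistoryAutonomyThresholdModulusShift — (E47d) THE FUNCTIONAL DIRECTION IS EXACT TOO: shifting the kink functional of (E47b) by a
# constant `η ≥ 0` — `κ_{q,η}(u) = 2 + η + 6q·(1 − √3·u₀)₊` on ]0,1]^ℕ (floor `2`, zeroth moment `6√3·q`, ratio `q`; `sup |κ_{q,η} − κ_{q,0}| = η`) — moves the
# box solution from the pin `1` AT SCALE 1 by at least `η∕(68(1−q))` in the Lipschitz regime `η ≤ 9(1−q)²`, by at least `√η∕20` in the Hölder regime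
# `9(1−q)² ≤ η`, and by at least `√η∕10` AT the threshold `q = 1` — against (E47a)'s `abs_sub_le_of_functionals`-type upper bounds `η∕(6√3(1−q))` ((E38b))
# and `√(η∕(6√3·q))`: the `1∕2`-Hölder dependence on the FUNCTIONAL at the threshold is attained in order, exactly as the dependence on the pin ((E47b))

Cell `pub-balaban`, β-function sub-cell, BINDER row D4 «RemainderConst leaves for Bałaban's split» (`HOME/BINDER-OWNERS.md`; owner lineage `b2b-balaban-beta-an4`;
this file by co-owner #2 lineage `b2b-balaban-beta-d4-p2`, generation 42), β-FLOW TEAM duty (1), FREEZE (0) honoured (def-free: the family is an explicit lambda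
in every statement, no declaration, no notation; node U2's `MemFlow` ∕ `SeqBox`, (E40)'s `exists_memFlow_zm` BY NAME).  Companion of (E47a) `…ThresholdModulus`
and (E47b) `…ThresholdModulusWitness` (the PIN direction; neither imported — this file is self-contained below (E40)); the pinching against (E47a) is spelled
out in (E47c) `…ThresholdModulusExact`.  At `η = 0` the family is (E47b)'s `κ_q`, whose pin-1 solutions all sit at the corner `h(1) = 1∕√3`
((E47b) `apply_one_eq_of_pin_one`); here the gap is therefore stated as `1∕√3 − h′(1)`.

HONEST FRAMING (page 1, verbatim and binding).  *"Discharging BetaPertH makes Bałaban's UV stability UNCONDITIONAL — a real constructive-QFT result; it is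
NOT the continuum limit and NOT the Clay problem."*  THIS FILE DISCHARGES NOTHING OF THE KIND.  A kernel TOY family of Markov functionals on ]0,1] and
elementary real analysis; whether Bałaban's limit functional is Markov, which constants it has and on which side of the threshold it sits is NOT PRINTED
([I] p. 298) and not asserted.  Row D4 class UNCHANGED (critical-path width 0; instance 0∕1; D4 DISCHARGE NO DATE).  HONEST DEPENDENCY: continuum YM on
T⁴ ⇐ BetaPertH ∧ nine spine estimates (0/9 proved); BetaPertH ⇐ (D1) ∧ (D4) ∧ CAP+tail; G-an2-4 gates asym, D1 and NE2/3/4.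

THE WITNESS.  `γ = 1`, `b = 2`, pin `1`, functional `u ↦ 2 + η + 6q·max(1 − √3·u 0, 0)` (`q ∈ [0,1]`, `η ≥ 0`).  For a box solution `h` the scale-1 step equation
reads, in `s = √3·h(1) ∈ ]0,1]`: `3∕s² = 3 + η + 6q(1 − s)`, i.e. with `t = 1 − s`: `η = 6(1−q)·t + 9t² + 3t³(4−3t)∕(1−t)²` — (E47b)'s identity with the pin
forcing `1∕p² − 1` replaced by the functional forcing `η`.  For `η ≤ 3`: `t ≤ 1∕2` and `6(1−q)t + 9t² ≤ η ≤ 6(1−q)t + 33t²` (§3), which pins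
`t = √3·(1∕√3 − h(1))` in both regimes (§4).

WHAT IS PROVED ([folklore]; 0 `def`, 0 sorry).  §1 `two_le_kinkS`, `abs_kinkS_sub_le`, `zerothMoment_kinkS`, `abs_kinkS_sub_kink` (`= η`), `exists_solutionS`.
§2 `step_oneS`, `sqrt3_mul_le_oneS`, `scaled_stepS`, `three_eq_mul_sqS`.  §3 `half_le_sqrt3_mulS`, **`forcing_geS`**, **`forcing_leS`**.  §4 ENDs:
**`shift_gap_lipschitz_regime`** (`η∕(68(1−q)) ≤ 1∕√3 − h(1)`), **`shift_gap_hoelder_regime`** (`√η∕20 ≤ 1∕√3 − h(1)`), **`shift_gap_at_threshold`**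
(`√η∕10 ≤ 1∕√3 − h(1)`), `shift_gap_le` (`1∕√3 − h(1) ≤ √η∕5`), **`not_lipschitz_in_functional_at_threshold`**.
-/

noncomputable section
open Filter Topology Finset

namespace Summit.QuantumFields.BalabanUV.Beta.EriceRemainderEnclosureHistoryAutonomyThresholdModulusShift

open Literature.MathematicalPhysics.QuantumFieldTheory.Balaban1983to89
open Literature.MathematicalPhysics.QuantumFieldTheory.Balaban1983to89.T4BetaStationary
open Literature.MathematicalPhysics.QuantumFieldTheory.Balaban1983to89.T4BetaFlowWellPosed
open Summit.QuantumFields.BalabanUV.Beta.EriceRemainderEnclosureHistoryAutonomyExistence (exists_memFlow_zm)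

variable {q η : ℝ} {h : ℕ → ℝ}

/-! ## §1 The shifted kink functional -/

/-- FLOOR `2` (`q, η ≥ 0`). [folklore] -/
theorem two_le_kinkS (hq : 0 ≤ q) (hη : 0 ≤ η) (u : ℕ → ℝ) : 2 ≤ 2 + η + 6 * q * max (1 - Real.sqrt 3 * u 0) 0 := by
  have : 0 ≤ 6 * q * max (1 - Real.sqrt 3 * u 0) 0 := mul_nonneg (by positivity) (le_max_right _ _)
  linarith

/-- ZEROTH MOMENT `6√3·q`, independent of the shift. [folklore] -/
theorem abs_kinkS_sub_le (hq : 0 ≤ q) (u u' : ℕ → ℝ) {D : ℝ} (hD : |u 0 - u' 0| ≤ D) :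
    |(2 + η + 6 * q * max (1 - Real.sqrt 3 * u 0) 0) - (2 + η + 6 * q * max (1 - Real.sqrt 3 * u' 0) 0)| ≤ 6 * Real.sqrt 3 * q * D := by
  have h1 : |max (1 - Real.sqrt 3 * u 0) 0 - max (1 - Real.sqrt 3 * u' 0) 0| ≤ Real.sqrt 3 * |u 0 - u' 0| := by
    refine (abs_max_sub_max_le_abs _ _ _).trans ?_
    rw [show (1 - Real.sqrt 3 * u 0) - (1 - Real.sqrt 3 * u' 0) = -(Real.sqrt 3 * (u 0 - u' 0)) by ring, abs_neg, abs_mul,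
      abs_of_nonneg (Real.sqrt_nonneg 3)]
  rw [show (2 + η + 6 * q * max (1 - Real.sqrt 3 * u 0) 0) - (2 + η + 6 * q * max (1 - Real.sqrt 3 * u' 0) 0)
      = 6 * q * (max (1 - Real.sqrt 3 * u 0) 0 - max (1 - Real.sqrt 3 * u' 0) 0) by ring, abs_mul,
    abs_of_nonneg (by positivity : (0 : ℝ) ≤ 6 * q)]
  calc 6 * q * |max (1 - Real.sqrt 3 * u 0) 0 - max (1 - Real.sqrt 3 * u' 0) 0|
      ≤ 6 * q * (Real.sqrt 3 * |u 0 - u' 0|) := mul_le_mul_of_nonneg_left h1 (by positivity)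
    _ ≤ 6 * q * (Real.sqrt 3 * D) :=
        mul_le_mul_of_nonneg_left (mul_le_mul_of_nonneg_left hD (Real.sqrt_nonneg 3)) (by positivity)
    _ = 6 * Real.sqrt 3 * q * D := by ring

/-- The zeroth-moment binder shape of (E37b)∕(E38a)∕(E40) for the shifted kink functional, `M = 6√3·q`. [folklore] -/
theorem zerothMoment_kinkS (hq : 0 ≤ q) :
    ∀ u u' : ℕ → ℝ, SeqBox 1 u → SeqBox 1 u' → ∀ D : ℝ, (∀ j, |u j - u' j| ≤ D) →
      |(2 + η + 6 * q * max (1 - Real.sqrt 3 * u 0) 0) - (2 + η + 6 * q * max (1 - Real.sqrt 3 * u' 0) 0)| ≤ 6 * Real.sqrt 3 * q * D :=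
  fun u u' _ _ _ hD => abs_kinkS_sub_le hq u u' (hD 0)

/-- THE DISTANCE OF THE FUNCTIONALS: `|κ_{q,0} u − κ_{q,η} u| = η` — the binder `hη` of (E47a) with equality. [folklore] -/
theorem abs_kinkS_sub_kink (hη : 0 ≤ η) (u : ℕ → ℝ) :
    |(2 + 0 + 6 * q * max (1 - Real.sqrt 3 * u 0) 0) - (2 + η + 6 * q * max (1 - Real.sqrt 3 * u 0) 0)| = η := by
  rw [show (2 + 0 + 6 * q * max (1 - Real.sqrt 3 * u 0) 0) - (2 + η + 6 * q * max (1 - Real.sqrt 3 * u 0) 0) = -η by ring,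
    abs_neg, abs_of_nonneg hη]

/-- EXISTENCE of a box solution from the pin `1`, by (E40) `exists_memFlow_zm`. [folklore] -/
theorem exists_solutionS (hq : 0 ≤ q) (hη : 0 ≤ η) :
    ∃ h : ℕ → ℝ, SeqBox 1 h ∧ MemFlow (fun u : ℕ → ℝ => 2 + η + 6 * q * max (1 - Real.sqrt 3 * u 0) 0) 1 h :=
  exists_memFlow_zm (γ := 1) (b := 2) (M := 6 * Real.sqrt 3 * q) (zerothMoment_kinkS hq) (by positivity) one_pos le_rfl two_pos
    (fun u _ => two_le_kinkS hq hη u)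

/-! ## §2 The scale-1 step equation in the window -/

/-- THE STEP EQUATION AT SCALE 1 from the pin `1`: `1∕h(1)² = 1 + (2 + η + 6q·(1 − √3·h(1))₊)`. [folklore] -/
theorem step_oneS (hf : MemFlow (fun u : ℕ → ℝ => 2 + η + 6 * q * max (1 - Real.sqrt 3 * u 0) 0) 1 h) :
    1 / h 1 ^ 2 = 1 + (2 + η + 6 * q * max (1 - Real.sqrt 3 * h 1) 0) := by
  have h0 := hf.2 0
  simp only [zero_add, add_zero] at h0
  rw [hf.1] at h0
  simpa using h0

/-- THE WINDOW: `√3·h(1) ≤ 1`. [folklore] -/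
theorem sqrt3_mul_le_oneS (hq : 0 ≤ q) (hη : 0 ≤ η) (hh : SeqBox 1 h)
    (hf : MemFlow (fun u : ℕ → ℝ => 2 + η + 6 * q * max (1 - Real.sqrt 3 * u 0) 0) 1 h) : Real.sqrt 3 * h 1 ≤ 1 := by
  have h1 := step_oneS hf
  have ha := (hh 1).1
  have hmax : 0 ≤ 6 * q * max (1 - Real.sqrt 3 * h 1) 0 := mul_nonneg (by positivity) (le_max_right _ _)
  have h3 : 3 ≤ 1 / h 1 ^ 2 := by linarith
  have h4 : 3 * h 1 ^ 2 ≤ 1 := by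
    rw [le_div_iff₀ (by positivity)] at h3
    linarith
  have h5 : (Real.sqrt 3 * h 1) ^ 2 ≤ 1 := by
    rw [mul_pow, Real.sq_sqrt (by norm_num : (0 : ℝ) ≤ 3)]
    linarith
  nlinarith [mul_nonneg (Real.sqrt_nonneg 3) ha.le]

/-- THE SCALED STEP EQUATION: `η = 3∕(√3·h(1))² − 3 − 6q·(1 − √3·h(1))` — the functional forcing against `s = √3·h(1)`. [folklore] -/
theorem scaled_stepS (hq : 0 ≤ q) (hη : 0 ≤ η) (hh : SeqBox 1 h)
    (hf : MemFlow (fun u : ℕ → ℝ => 2 + η + 6 * q * max (1 - Real.sqrt 3 * u 0) 0) 1 h) :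
    η = 3 / (Real.sqrt 3 * h 1) ^ 2 - 3 - 6 * q * (1 - Real.sqrt 3 * h 1) := by
  have h1 := step_oneS hf
  have hs := sqrt3_mul_le_oneS hq hη hh hf
  have ha := (hh 1).1.ne'
  rw [max_eq_left (sub_nonneg.2 hs)] at h1
  have e : 3 / (Real.sqrt 3 * h 1) ^ 2 = 1 / h 1 ^ 2 := by
    rw [mul_pow, Real.sq_sqrt (by norm_num : (0 : ℝ) ≤ 3)]
    field_simp
  rw [e]
  linarith

/-- `3 = (η + 3 + 6q(1 − s))·s²` — denominators cleared (`s = √3·h(1)`). [folklore] -/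
theorem three_eq_mul_sqS (hq : 0 ≤ q) (hη : 0 ≤ η) (hh : SeqBox 1 h)
    (hf : MemFlow (fun u : ℕ → ℝ => 2 + η + 6 * q * max (1 - Real.sqrt 3 * u 0) 0) 1 h) :
    3 = (η + 3 + 6 * q * (1 - Real.sqrt 3 * h 1)) * (Real.sqrt 3 * h 1) ^ 2 := by
  have hP := scaled_stepS hq hη hh hf
  have hs0 : 0 < Real.sqrt 3 * h 1 := mul_pos (Real.sqrt_pos.2 (by norm_num)) (hh 1).1
  have ha := (hh 1).1.ne'
  have e : 3 / (Real.sqrt 3 * h 1) ^ 2 = η + 3 + 6 * q * (1 - Real.sqrt 3 * h 1) := by linarith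
  rw [← e]
  field_simp

/-! ## §3 The two-sided forcing inequality (`η ≤ 3`) -/

/-- For `η ≤ 3` (and `q ≤ 1`): `√3·h(1) ≥ 1∕2` (`3∕s² ≤ 3 + η + 6q ≤ 12`). [folklore] -/
theorem half_le_sqrt3_mulS (hq0 : 0 ≤ q) (hq1 : q ≤ 1) (hη0 : 0 ≤ η) (hη3 : η ≤ 3) (hh : SeqBox 1 h)
    (hf : MemFlow (fun u : ℕ → ℝ => 2 + η + 6 * q * max (1 - Real.sqrt 3 * u 0) 0) 1 h) : 1 / 2 ≤ Real.sqrt 3 * h 1 := by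
  have hP := scaled_stepS hq0 hη0 hh hf
  have hs1 := sqrt3_mul_le_oneS hq0 hη0 hh hf
  set s := Real.sqrt 3 * h 1 with hs
  have hs0 : 0 < s := mul_pos (Real.sqrt_pos.2 (by norm_num)) (hh 1).1
  have hq2 : q * (1 - s) ≤ 1 := by
    have := mul_le_mul hq1 (by linarith : 1 - s ≤ 1) (sub_nonneg.2 hs1) zero_le_one
    linarith
  have h3 : 3 / s ^ 2 ≤ 12 := by linarith
  have h4 : 3 ≤ 12 * s ^ 2 := by rwa [div_le_iff₀ (by positivity)] at h3
  nlinarith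

/-- **THE FORCING FROM BELOW**: `6(1−q)·t + 9t² ≤ η`, `t = 1 − √3·h(1)` (`3 − 3s² − (6t + 9t²)s² = 3t³(4 − 3t) ≥ 0`). [folklore] -/
theorem forcing_geS (hq0 : 0 ≤ q) (hη0 : 0 ≤ η) (hh : SeqBox 1 h)
    (hf : MemFlow (fun u : ℕ → ℝ => 2 + η + 6 * q * max (1 - Real.sqrt 3 * u 0) 0) 1 h) :
    6 * (1 - q) * (1 - Real.sqrt 3 * h 1) + 9 * (1 - Real.sqrt 3 * h 1) ^ 2 ≤ η := by
  have e := three_eq_mul_sqS hq0 hη0 hh hf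
  have hs1 := sqrt3_mul_le_oneS hq0 hη0 hh hf
  set s := Real.sqrt 3 * h 1 with hs
  have hs0 : 0 < s := mul_pos (Real.sqrt_pos.2 (by norm_num)) (hh 1).1
  have ht0 : 0 ≤ 1 - s := sub_nonneg.2 hs1
  have key : (6 * (1 - q) * (1 - s) + 9 * (1 - s) ^ 2) * s ^ 2 ≤ η * s ^ 2 := by
    have hP : η * s ^ 2 = 3 - 3 * s ^ 2 - 6 * q * (1 - s) * s ^ 2 := by linear_combination -e
    rw [hP]
    nlinarith [mul_nonneg (pow_nonneg ht0 3) (by linarith : (0 : ℝ) ≤ 1 + 3 * s), mul_nonneg (mul_nonneg hq0 ht0) (sq_nonneg s)]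
  exact le_of_mul_le_mul_right key (by positivity)

/-- **THE FORCING FROM ABOVE**: for `η ≤ 3` (so `t ≤ 1∕2`), `η ≤ 6(1−q)·t + 33t²`, `t = 1 − √3·h(1)`
(`(6t + 33t²)s² − 3 + 3s² = t²(24 − 60t + 33t²) ≥ 0` on `[0, 1∕2]`). [folklore] -/
theorem forcing_leS (hq0 : 0 ≤ q) (hq1 : q ≤ 1) (hη0 : 0 ≤ η) (hη3 : η ≤ 3) (hh : SeqBox 1 h)
    (hf : MemFlow (fun u : ℕ → ℝ => 2 + η + 6 * q * max (1 - Real.sqrt 3 * u 0) 0) 1 h) :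
    η ≤ 6 * (1 - q) * (1 - Real.sqrt 3 * h 1) + 33 * (1 - Real.sqrt 3 * h 1) ^ 2 := by
  have e := three_eq_mul_sqS hq0 hη0 hh hf
  have hs1 := sqrt3_mul_le_oneS hq0 hη0 hh hf
  have hs2 := half_le_sqrt3_mulS hq0 hq1 hη0 hη3 hh hf
  set s := Real.sqrt 3 * h 1 with hs
  have hs0 : 0 < s := by linarith
  have ht0 : 0 ≤ 1 - s := sub_nonneg.2 hs1
  have hquad : 0 ≤ 24 - 60 * (1 - s) + 33 * (1 - s) ^ 2 := by nlinarith [sq_nonneg (1 - s - 1 / 2)]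
  have key : η * s ^ 2 ≤ (6 * (1 - q) * (1 - s) + 33 * (1 - s) ^ 2) * s ^ 2 := by
    have hP : η * s ^ 2 = 3 - 3 * s ^ 2 - 6 * q * (1 - s) * s ^ 2 := by linear_combination -e
    rw [hP]
    nlinarith [mul_nonneg (sq_nonneg (1 - s)) hquad, mul_nonneg (mul_nonneg hq0 ht0) (sq_nonneg s)]
  exact le_of_mul_le_mul_right key (by positivity)

/-- `√3·(1∕√3 − h(1)) = 1 − √3·h(1)`. [folklore] -/
theorem sqrt3_mul_corner_sub (x : ℝ) : Real.sqrt 3 * (1 / Real.sqrt 3 - x) = 1 - Real.sqrt 3 * x := by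
  have : (0 : ℝ) < Real.sqrt 3 := Real.sqrt_pos.2 (by norm_num)
  field_simp

/-! ## §4 ENDs: the functional direction, both regimes and the threshold -/

/-- **LIPSCHITZ REGIME** (`0 ≤ q < 1`, `0 ≤ η ≤ min(3, 9(1−q)²)`): `η∕(68(1−q)) ≤ 1∕√3 − h(1)` — against (E38b)'s ∕ (E47a)'s
`sup_j |h_j − h′_j| ≤ η∕(6√3·(1−q))` in the functional direction for this instance. [folklore] -/
theorem shift_gap_lipschitz_regime (hq0 : 0 ≤ q) (hq1 : q < 1) (hη0 : 0 ≤ η) (hη3 : η ≤ 3) (hreg : η ≤ 9 * (1 - q) ^ 2)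
    (hh : SeqBox 1 h) (hf : MemFlow (fun u : ℕ → ℝ => 2 + η + 6 * q * max (1 - Real.sqrt 3 * u 0) 0) 1 h) :
    η / (68 * (1 - q)) ≤ 1 / Real.sqrt 3 - h 1 := by
  have hlo := forcing_geS hq0 hη0 hh hf
  have hup := forcing_leS hq0 hq1.le hη0 hη3 hh hf
  have hs1 := sqrt3_mul_le_oneS hq0 hη0 hh hf
  have hd := sqrt3_mul_corner_sub (h 1)
  set t := 1 - Real.sqrt 3 * h 1 with ht
  have ht0 : 0 ≤ t := sub_nonneg.2 hs1
  have h1q : 0 < 1 - q := sub_pos.2 hq1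
  have htq : t ≤ 1 - q := by
    have : t ^ 2 ≤ (1 - q) ^ 2 := by nlinarith
    exact (pow_le_pow_iff_left₀ ht0 h1q.le two_ne_zero).1 this
  have hP : η ≤ 39 * (1 - q) * t := by nlinarith [mul_le_mul_of_nonneg_left htq (by positivity : (0 : ℝ) ≤ 33 * t)]
  have h3 : (39 : ℝ) * Real.sqrt 3 ≤ 68 := by nlinarith [Real.sq_sqrt (by norm_num : (0 : ℝ) ≤ 3), Real.sqrt_nonneg 3]
  have h30 : (0 : ℝ) < Real.sqrt 3 := Real.sqrt_pos.2 (by norm_num)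
  have hd0 : 0 ≤ 1 / Real.sqrt 3 - h 1 := by nlinarith
  rw [div_le_iff₀ (by positivity)]
  calc η ≤ 39 * (1 - q) * t := hP
    _ = 39 * Real.sqrt 3 * (1 - q) * (1 / Real.sqrt 3 - h 1) := by rw [← hd]; ring
    _ ≤ 68 * (1 - q) * (1 / Real.sqrt 3 - h 1) := by nlinarith [mul_nonneg h1q.le hd0]
    _ = (1 / Real.sqrt 3 - h 1) * (68 * (1 - q)) := by ring

/-- **HÖLDER REGIME** (`0 ≤ q ≤ 1`, `9(1−q)² ≤ η ≤ 3`): `√η∕20 ≤ 1∕√3 − h(1)` — against (E47a)'s `√(η∕(6√3·q))` in the functional direction. [folklore] -/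
theorem shift_gap_hoelder_regime (hq0 : 0 ≤ q) (hq1 : q ≤ 1) (hη0 : 0 ≤ η) (hη3 : η ≤ 3) (hreg : 9 * (1 - q) ^ 2 ≤ η)
    (hh : SeqBox 1 h) (hf : MemFlow (fun u : ℕ → ℝ => 2 + η + 6 * q * max (1 - Real.sqrt 3 * u 0) 0) 1 h) :
    Real.sqrt η / 20 ≤ 1 / Real.sqrt 3 - h 1 := by
  have hup := forcing_leS hq0 hq1 hη0 hη3 hh hf
  have hs1 := sqrt3_mul_le_oneS hq0 hη0 hh hf
  have hd := sqrt3_mul_corner_sub (h 1)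
  set t := 1 - Real.sqrt 3 * h 1 with ht
  have ht0 : 0 ≤ t := sub_nonneg.2 hs1
  set r := Real.sqrt η with hr
  have hr0 : 0 ≤ r := Real.sqrt_nonneg _
  have hr2 : r ^ 2 = η := Real.sq_sqrt hη0
  have hqr : 3 * (1 - q) ≤ r := by
    rw [hr, show 3 * (1 - q) = Real.sqrt ((3 * (1 - q)) ^ 2) by rw [Real.sqrt_sq (by linarith)]]
    exact Real.sqrt_le_sqrt (by nlinarith)
  have hrt : r ≤ 11 * t := by
    by_contra hcon
    push Not at hcon
    have hr' : 0 < r := lt_of_le_of_lt (by positivity) hcon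
    nlinarith [mul_le_mul_of_nonneg_right hqr ht0, mul_lt_mul_of_pos_left hcon hr']
  have h3 : (11 : ℝ) * Real.sqrt 3 ≤ 20 := by nlinarith [Real.sq_sqrt (by norm_num : (0 : ℝ) ≤ 3), Real.sqrt_nonneg 3]
  have h30 : (0 : ℝ) < Real.sqrt 3 := Real.sqrt_pos.2 (by norm_num)
  have hd0 : 0 ≤ 1 / Real.sqrt 3 - h 1 := by nlinarith
  rw [div_le_iff₀ (by norm_num : (0 : ℝ) < 20)]
  calc r ≤ 11 * t := hrt
    _ = 11 * Real.sqrt 3 * (1 / Real.sqrt 3 - h 1) := by rw [← hd]; ring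
    _ ≤ 20 * (1 / Real.sqrt 3 - h 1) := by nlinarith
    _ = (1 / Real.sqrt 3 - h 1) * 20 := by ring

/-- **AT THE THRESHOLD** (`q = 1`, `0 ≤ η ≤ 3`): `√η∕10 ≤ 1∕√3 − h(1)` — raising the threshold functional by `η` moves the solution at scale 1 by
`≍ √η`: (E47a)'s `1∕2`-Hölder modulus in the functional (`≤ √(γ²η∕(3√3b)) = √(η∕(6√3))` here) is attained in order. [folklore] -/
theorem shift_gap_at_threshold (hη0 : 0 ≤ η) (hη3 : η ≤ 3) (hh : SeqBox 1 h)
    (hf : MemFlow (fun u : ℕ → ℝ => 2 + η + 6 * 1 * max (1 - Real.sqrt 3 * u 0) 0) 1 h) :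
    Real.sqrt η / 10 ≤ 1 / Real.sqrt 3 - h 1 := by
  have hup := forcing_leS (q := 1) zero_le_one le_rfl hη0 hη3 hh hf
  have hs1 := sqrt3_mul_le_oneS (q := 1) zero_le_one hη0 hh hf
  have hd := sqrt3_mul_corner_sub (h 1)
  set t := 1 - Real.sqrt 3 * h 1 with ht
  have ht0 : 0 ≤ t := sub_nonneg.2 hs1
  have hP : η ≤ 33 * t ^ 2 := by linarith
  have h30 : (0 : ℝ) < Real.sqrt 3 := Real.sqrt_pos.2 (by norm_num)
  have hsq : Real.sqrt 3 * Real.sqrt η ≤ 10 * t := by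
    rw [← Real.sqrt_mul (by norm_num : (0 : ℝ) ≤ 3),
      show 10 * t = Real.sqrt ((10 * t) ^ 2) by rw [Real.sqrt_sq (by positivity)]]
    exact Real.sqrt_le_sqrt (by nlinarith)
  rw [div_le_iff₀ (by norm_num : (0 : ℝ) < 10)]
  have : Real.sqrt 3 * Real.sqrt η ≤ Real.sqrt 3 * ((1 / Real.sqrt 3 - h 1) * 10) := by
    calc Real.sqrt 3 * Real.sqrt η ≤ 10 * t := hsq
      _ = Real.sqrt 3 * ((1 / Real.sqrt 3 - h 1) * 10) := by rw [← hd]; ring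
  exact le_of_mul_le_mul_left this h30

/-- THE GAP FROM ABOVE, FOR THE RECORD (`0 ≤ q ≤ 1`, `η ≥ 0`): `1∕√3 − h(1) ≤ √η∕5` (`9t² ≤ η`, `5 ≤ 3√3`) — the same order as the lower bounds. [folklore] -/
theorem shift_gap_le (hq0 : 0 ≤ q) (hq1 : q ≤ 1) (hη0 : 0 ≤ η) (hh : SeqBox 1 h)
    (hf : MemFlow (fun u : ℕ → ℝ => 2 + η + 6 * q * max (1 - Real.sqrt 3 * u 0) 0) 1 h) :
    1 / Real.sqrt 3 - h 1 ≤ Real.sqrt η / 5 := by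
  have hlo := forcing_geS hq0 hη0 hh hf
  have hs1 := sqrt3_mul_le_oneS hq0 hη0 hh hf
  have hd := sqrt3_mul_corner_sub (h 1)
  set t := 1 - Real.sqrt 3 * h 1 with ht
  have ht0 : 0 ≤ t := sub_nonneg.2 hs1
  have h9 : (3 * t) ^ 2 ≤ η := by nlinarith [mul_nonneg (sub_nonneg.2 hq1) ht0]
  have h3t : 3 * t ≤ Real.sqrt η := Real.le_sqrt_of_sq_le h9
  have h30 : (0 : ℝ) < Real.sqrt 3 := Real.sqrt_pos.2 (by norm_num)
  have h5 : (5 : ℝ) ≤ 3 * Real.sqrt 3 := by nlinarith [Real.sq_sqrt (by norm_num : (0 : ℝ) ≤ 3)]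
  have hd0 : 0 ≤ 1 / Real.sqrt 3 - h 1 := by nlinarith
  rw [le_div_iff₀ (by norm_num : (0 : ℝ) < 5)]
  calc (1 / Real.sqrt 3 - h 1) * 5 ≤ (1 / Real.sqrt 3 - h 1) * (3 * Real.sqrt 3) := mul_le_mul_of_nonneg_left h5 hd0
    _ = 3 * t := by rw [← hd]; ring
    _ ≤ Real.sqrt η := h3t

/-- **NO LIPSCHITZ DEPENDENCE ON THE FUNCTIONAL AT THE THRESHOLD**: for every `L` there are a shift `η ∈ ]0, 3]` and a box solution `h` of the shifted
threshold kink flow from the pin `1` (it exists, (E40)) with `1∕√3 − h(1) > L·η`, `η = sup |κ_{1,0} − κ_{1,η}|` — (E38b)'s `1∕(1 − q)` in the functional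
direction is genuinely infinite at `q = 1`. [folklore] -/
theorem not_lipschitz_in_functional_at_threshold (L : ℝ) :
    ∃ η : ℝ, 0 < η ∧ η ≤ 3 ∧ ∃ h : ℕ → ℝ,
      SeqBox 1 h ∧ MemFlow (fun u : ℕ → ℝ => 2 + η + 6 * 1 * max (1 - Real.sqrt 3 * u 0) 0) 1 h ∧ L * η < 1 / Real.sqrt 3 - h 1 := by
  -- a forcing `η ∈ ]0,3]` with `L·η < √η∕10`
  obtain ⟨P, hP0, hP3, hLP⟩ : ∃ P : ℝ, 0 < P ∧ P ≤ 3 ∧ L * P < Real.sqrt P / 10 := by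
    rcases le_or_gt L 0 with hL | hL
    · refine ⟨3, by norm_num, le_rfl, ?_⟩
      have h1 : L * 3 ≤ 0 := by nlinarith
      have h2 : 0 < Real.sqrt 3 / 10 := by positivity
      linarith
    · refine ⟨min 3 (1 / (200 * L ^ 2)), lt_min (by norm_num) (by positivity), min_le_left _ _, ?_⟩
      set P := min 3 (1 / (200 * L ^ 2)) with hPdef
      have hP0 : 0 < P := lt_min (by norm_num) (by positivity)
      have hPle : P ≤ 1 / (200 * L ^ 2) := min_le_right _ _
      have h1 : P * (200 * L ^ 2) ≤ 1 := (le_div_iff₀ (by positivity)).1 hPle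
      have h2 : (10 * (L * P)) ^ 2 < Real.sqrt P ^ 2 := by
        rw [Real.sq_sqrt hP0.le]
        nlinarith [mul_pos hP0 hP0, mul_pos hL hP0]
      have h3 : 10 * (L * P) < Real.sqrt P := lt_of_pow_lt_pow_left₀ 2 (Real.sqrt_nonneg P) h2
      linarith
  obtain ⟨h, hh, hf⟩ := exists_solutionS (q := 1) (η := P) zero_le_one hP0.le
  exact ⟨P, hP0, hP3, h, hh, hf, hLP.trans_le (shift_gap_at_threshold hP0.le hP3 hh hf)⟩

end Summit.QuantumFields.BalabanUV.Beta.EriceRemainderEnclosureHistoryAutonomyThresholdModulusShift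

end
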